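import Summits.QuantumFields.BalabanUV.T4Continuum.Support.RegionElectricCommutation
import Summits.QuantumFields.BalabanUV.T4Continuum.Support.RegionNormPairingTools
import Summits.QuantumFields.BalabanUV.T4Continuum.Support.RegionGaugeResolventSplit
import Summits.QuantumFields.BalabanUV.T4Continuum.Support.RegionSliceCoerciveBox

/-!
# T⁴ programme, spine node NE2 (U1a), sub-row Δ1 «NE2⁰-Dirichlet» — THE CORNER-FREE H² OF THE ELECTRIC OPERATOR ON PRODUCT REGIONS:
# `Σ_μ ‖W_μ A‖² ≤ ‖(curlRᴴcurlR + gradR·gradRᴴ) A‖²` (constant 1, every `IsCoordBox`, every level `n ≥ 2`, every `A`), and the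
# Hessian budget `√(Σ_μ ‖W_μ G̃f‖²) ≤ (1 + a‖G̃‖)·‖f‖` of the local propagator `G̃ = Δ_loc⁻¹`

NE2 formalisation swarm `b2b-balaban-t4-ne2-formalise-*`, LEAF PROVER 02 (gen 8), supplier item «Δ1-LOC-HESS» (owner R34 (b)'s (R-hess-interior),
re-targeted per owner g15's O15-a (W-a) to the LOCAL operator `Δ_loc = curlRᴴcurlR + gradR·gradRᴴ + a n^d·avgRᴴavgR` — «(R) budgets for
G̃, whose H² is corner-free SCALAR business»), file 3 of 3, on file 1 `Support/RegionElectricSplitting` (the directional pieces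
`W_μ = (Idiff μ)ᴴ·Idiff μ + diag(n²·tcnt μ)` and `electric_splitting : curlRᴴcurlR + gradR·gradRᴴ = Σ_μ W_μ` under H1) and file 2 `Support/RegionElectricCommutation`
(on product regions `Idiff μ` COMMUTES with `Idiff μ′`, `(Idiff μ′)ᴴ`, `Dg μ′ = diag(n²·tcnt μ′)` for `μ ≠ μ′`).  The scalar all-Dirichlet model
is gan24-p2-g22's `DirichletBoxRegularity.hdiag_le_sum_normSq_LapS` (corner-free zero-extension argument); here the own direction of each
component is NEUMANN, and the commutations replace the zero-extension argument:
 * §4 hence the CROSS TERMS are nonnegative, **`re_cross_nonneg`**: `re⟨W_μ A, W_μ′ A⟩ = ‖Idiff μ (Idiff μ′ A)‖² + Σ n²tcnt μ′‖Idiff μ A‖²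
   + Σ n²tcnt μ‖Idiff μ′ A‖² + Σ n⁴tcnt μ tcnt μ′‖A‖² ≥ 0`, and the END **`sum_nsq_Wdir_le : Σ_μ ‖W_μ A‖² ≤ ‖(Σ_μ W_μ)A‖²`** (every product
   region, EVERY level `n ≥ 1`, every `A`): the lattice corner-free H² of the mixed Neumann ∕ Dirichlet box problem, constant 1.
 * §5 with file 1's splitting (`n ≥ 2`): **`hessian_le_nsq_electric`** `Σ_μ ‖W_μ A‖² ≤ ‖(curlRᴴcurlR + gradR·gradRᴴ)A‖²`; modulo ANY
   perturbation `P` (`sqrt_hessian_le_add`); for the local operator **`sqrt_hessian_le_loc`** `√(Σ_μ‖W_μ A‖²) ≤ ‖Δ_loc A‖ + a‖A‖`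
   (`RegionNormPairingTools.sqrt_nsq_mass_le`); and the (R)-HESSIAN BUDGET **`hessian_budget_loc`**: `Δ_loc` invertible with `‖Δ_loc⁻¹‖ ≤ Γ`
   ⟹ `√(Σ_μ ‖W_μ(Δ_loc⁻¹f)‖²) ≤ (1 + aΓ)·‖f‖` — LEVEL-FREE in whatever `Γ` is (on boxes `Γ = γ⋆⁻¹` from W1: the sequel
   `Support/RegionElectricHessianBox`).  The budget `Σ_μ ‖W_μ v‖²` is, component by component, gan24's `budget_μ` currency (zero-extension
   `Pdir_μ` read on the support) in the transverse directions and the Neumann second difference in the own direction — the (R)-side input the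
   two-level commutator pairing (P-gaffney) of `Δ_loc` is to be bounded against.

HONEST FRAMING (T4-DAG p. 1).  Lattice calculus at MODEL level (`U = 1`, ONE region = a product of coordinate sets, finite torus); statements
OURS ([folklore]); nothing printed is a hypothesis ([B9] prints only η-uniform bounds (3.42) for these propagators; an H² estimate for the
lattice electric box problem is «not in print; our proof»); general unions of blocks (re-entrant edges) NOT covered; (P-gaffney), (W-b), (W-c)
OPEN; W3 on boxes OPEN; Δ1 NOT closed; NE2 (U1a) NOT proved; spine PROVED 0/9 unchanged; NOT [B9] (3.16)/(3.23)–(3.27) as printed; NOT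
infinite volume, NOT a mass gap, NOT the Clay problem.  HONEST DEPENDENCY: continuum YM on T⁴ ⇐ BetaPertH ∧ nine spine estimates (0/9
proved); BetaPertH ⇐ (D1) ∧ (D4) ∧ CAP+tail; G-an2-4 gates asym, D1 and NE2/3/4.  No `sorry`.
-/

noncomputable section

open scoped BigOperators ComplexConjugate Matrix Matrix.Norms.L2Operator
open Finset

namespace Summit.QuantumFields.BalabanUV.T4Continuum.RegionElectricHessian

open Literature.MathematicalPhysics.QuantumFieldTheory.Balaban1983to89.B5Prop11Plancherel (Tor fine unitVec)
open Literature.MathematicalPhysics.QuantumFieldTheory.Balaban1983to89.B5Prop11Lower (nsq nsq_nonneg star_dotProduct_self)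
open Literature.MathematicalPhysics.QuantumFieldTheory.Balaban1983to89.B5Action121 (star_mulVec_dotProduct)
open Summit.QuantumFields.BalabanUV.T4Continuum
open Summit.QuantumFields.BalabanUV.T4Continuum.RegionGaugeFixedVector (starReg curlR gradR avgR)
open Summit.QuantumFields.BalabanUV.T4Continuum.RegionElectricSplitting (Idiff tcnt tcnt_nonneg Wdir form_diagonal_ofReal electric_splitting_box)
open Summit.QuantumFields.BalabanUV.T4Continuum.RegionElectricCommutation (Dg Wdir_eq Idiff_Idiff_comm Idiff_IdiffH_comm Idiff_Dg_comm)
open Summit.QuantumFields.BalabanUV.T4Continuum.RegionNormPairingTools (sqrt_nsq_mass_le sqrt_nsq_mulVec_le)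
open Summit.QuantumFields.BalabanUV.T4Continuum.DirichletDirectionalBesov (sqrt_nsq_add_le nsq_neg)
open Summit.QuantumFields.BalabanUV.T4Continuum.SubtypeCompression (Coercive)
open Summit.QuantumFields.BalabanUV.T4Continuum.RegionStarBoundaryCharges (AtMostOneNeighbour atMostOneNeighbour_of_isCoordBox)
open Summit.QuantumFields.BalabanUV.T4Continuum.RegionElectricSplitting (electric_splitting)
open Summit.QuantumFields.BalabanUV.T4Continuum.RegionGaugeFixedVector (regionDeltaA)
open Summit.QuantumFields.BalabanUV.T4Continuum.RegionGaugeResolventSplit (regionDeltaLoc regionDeltaLoc_eq opNorm_inv_regionDeltaLoc_le)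
open Summit.QuantumFields.BalabanUV.T4Continuum.DirichletStarVectorTower (gamStar gamStar_pos two_le_lev_succ)
open Summit.QuantumFields.BalabanUV.T4Continuum.RegionGaugePoincareBox (cW1 cW1_pos)
open Summit.QuantumFields.BalabanUV.T4Continuum.RegionSliceCoerciveBox (coercive_regionDeltaA_box)
open Literature.MathematicalPhysics.QuantumFieldTheory.Balaban1983to89.B5G183RateUnitTower (lev)
open Summit.QuantumFields.BalabanUV.Beta.GAN24.DirichletBoxTwoLevel (IsCoordBox)

variable {d : ℕ}

section Region

variable (n : ℕ) [NeZero n] (M : Fin d → ℕ) [hM : ∀ μ, NeZero (M μ)] (S : Tor M → Prop) [DecidablePred S]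

/-! ## §4 The cross terms are nonnegative; the corner-free H² -/

/-- the pairing of two real-diagonal images: `⟨diag(c)A, diag(c′)A⟩ = Σ_b c_b c′_b ‖A b‖²`. [folklore] -/
theorem star_Dg_dotProduct_Dg (μ μ' : Fin d) (A : {b // starReg n M S b} → ℂ) :
    star (Dg n M S μ *ᵥ A) ⬝ᵥ (Dg n M S μ' *ᵥ A)
      = ((∑ b : {b // starReg n M S b}, ((n : ℝ) ^ 2 * tcnt n M S μ b.1) * ((n : ℝ) ^ 2 * tcnt n M S μ' b.1) * ‖A b‖ ^ 2 : ℝ) : ℂ) := by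
  rw [Complex.ofReal_sum]
  unfold dotProduct Dg
  refine sum_congr rfl fun b _ => ?_
  rw [Pi.star_apply, Matrix.mulVec_diagonal, Matrix.mulVec_diagonal, star_mul', Complex.star_def, Complex.conj_ofReal]
  push_cast
  rw [← Complex.conj_mul']
  ring

/-- the pairing of a real-diagonal image against the vector: `⟨diag(c)u, u⟩ = Σ_b c_b ‖u b‖²`. [folklore] -/
theorem star_Dg_dotProduct (μ : Fin d) (u : {b // starReg n M S b} → ℂ) :
    star (Dg n M S μ *ᵥ u) ⬝ᵥ u = ((∑ b : {b // starReg n M S b}, ((n : ℝ) ^ 2 * tcnt n M S μ b.1) * ‖u b‖ ^ 2 : ℝ) : ℂ) := by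
  rw [Complex.ofReal_sum]
  unfold dotProduct Dg
  refine sum_congr rfl fun b _ => ?_
  rw [Pi.star_apply, Matrix.mulVec_diagonal, star_mul', Complex.star_def, Complex.conj_ofReal]
  push_cast
  rw [← Complex.conj_mul']
  ring

section Coord

variable {S₀ : (μ : Fin d) → Finset (ZMod (M μ))} (hS₀ : ∀ b, S b ↔ ∀ μ, b μ ∈ S₀ μ)
include hS₀

/-- **THE CROSS TERMS ARE NONNEGATIVE**: `0 ≤ re⟨W_μ A, W_μ′ A⟩` for `μ ≠ μ′` on a product region — it equals
`‖Idiff μ (Idiff μ′ A)‖² + Σ n²tcnt μ′·‖Idiff μ A‖² + Σ n²tcnt μ·‖Idiff μ′ A‖² + Σ n⁴ tcnt μ·tcnt μ′·‖A‖²`. [folklore] -/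
theorem re_cross_nonneg {μ μ' : Fin d} (hμ : μ ≠ μ') (A : {b // starReg n M S b} → ℂ) :
    0 ≤ (star (Wdir n M S μ *ᵥ A) ⬝ᵥ (Wdir n M S μ' *ᵥ A)).re := by
  set X := Idiff n M S μ
  set X' := Idiff n M S μ'
  have hW : Wdir n M S μ *ᵥ A = Xᴴ *ᵥ (X *ᵥ A) + Dg n M S μ *ᵥ A := by
    rw [Wdir_eq, Matrix.add_mulVec, Matrix.mulVec_mulVec]
  have hW' : Wdir n M S μ' *ᵥ A = X'ᴴ *ᵥ (X' *ᵥ A) + Dg n M S μ' *ᵥ A := by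
    rw [Wdir_eq, Matrix.add_mulVec, Matrix.mulVec_mulVec]
  -- the four terms
  have t1 : star (Xᴴ *ᵥ (X *ᵥ A)) ⬝ᵥ (X'ᴴ *ᵥ (X' *ᵥ A)) = ((nsq (X *ᵥ (X' *ᵥ A)) : ℝ) : ℂ) := by
    rw [star_mulVec_dotProduct, Matrix.conjTranspose_conjTranspose, Idiff_IdiffH_comm n M S hS₀ hμ, ← star_mulVec_dotProduct,
      ← Idiff_Idiff_comm n M S hS₀ hμ, star_dotProduct_self]
  have t2 : star (Xᴴ *ᵥ (X *ᵥ A)) ⬝ᵥ (Dg n M S μ' *ᵥ A)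
      = ((∑ b : {b // starReg n M S b}, ((n : ℝ) ^ 2 * tcnt n M S μ' b.1) * ‖(X *ᵥ A) b‖ ^ 2 : ℝ) : ℂ) := by
    rw [star_mulVec_dotProduct, Matrix.conjTranspose_conjTranspose, Idiff_Dg_comm n M S hS₀ hμ]
    exact form_diagonal_ofReal _ _
  have t3 : star (Dg n M S μ *ᵥ A) ⬝ᵥ (X'ᴴ *ᵥ (X' *ᵥ A))
      = ((∑ b : {b // starReg n M S b}, ((n : ℝ) ^ 2 * tcnt n M S μ b.1) * ‖(X' *ᵥ A) b‖ ^ 2 : ℝ) : ℂ) := by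
    rw [← star_mulVec_dotProduct, Idiff_Dg_comm n M S hS₀ hμ.symm]
    exact star_Dg_dotProduct n M S μ _
  have t4 := star_Dg_dotProduct_Dg n M S μ μ' A
  rw [hW, hW', star_add, add_dotProduct, dotProduct_add, dotProduct_add, t1, t2, t3, t4]
  simp only [Complex.add_re, Complex.ofReal_re]
  have n2 : 0 ≤ (n : ℝ) ^ 2 := sq_nonneg _
  have s1 := nsq_nonneg (X *ᵥ (X' *ᵥ A))
  have s2 : 0 ≤ ∑ b : {b // starReg n M S b}, ((n : ℝ) ^ 2 * tcnt n M S μ' b.1) * ‖(X *ᵥ A) b‖ ^ 2 :=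
    sum_nonneg fun b _ => mul_nonneg (mul_nonneg n2 (tcnt_nonneg n M S μ' b.1)) (sq_nonneg _)
  have s3 : 0 ≤ ∑ b : {b // starReg n M S b}, ((n : ℝ) ^ 2 * tcnt n M S μ b.1) * ‖(X' *ᵥ A) b‖ ^ 2 :=
    sum_nonneg fun b _ => mul_nonneg (mul_nonneg n2 (tcnt_nonneg n M S μ b.1)) (sq_nonneg _)
  have s4 : 0 ≤ ∑ b : {b // starReg n M S b}, ((n : ℝ) ^ 2 * tcnt n M S μ b.1) * ((n : ℝ) ^ 2 * tcnt n M S μ' b.1) * ‖A b‖ ^ 2 :=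
    sum_nonneg fun b _ => mul_nonneg (mul_nonneg (mul_nonneg n2 (tcnt_nonneg n M S μ b.1))
      (mul_nonneg n2 (tcnt_nonneg n M S μ' b.1))) (sq_nonneg _)
  linarith

/-- **THE CORNER-FREE H² OF THE ELECTRIC OPERATOR** (constant 1): on a product region, at every level, for EVERY field on the star
bonds, `Σ_μ ‖W_μ A‖² ≤ ‖(Σ_μ W_μ) A‖²`. [folklore] -/
theorem sum_nsq_Wdir_le (A : {b // starReg n M S b} → ℂ) :
    ∑ μ, nsq (Wdir n M S μ *ᵥ A) ≤ nsq ((∑ μ, Wdir n M S μ) *ᵥ A) := by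
  set v : Fin d → {b // starReg n M S b} → ℂ := fun μ => Wdir n M S μ *ᵥ A with hv
  have hsum : (∑ μ, Wdir n M S μ) *ᵥ A = ∑ μ, v μ := by rw [Matrix.sum_mulVec]
  -- `‖Σ v_μ‖² = Σ_μ Σ_μ′ re⟨v_μ, v_μ′⟩`
  have hexp : nsq (∑ μ, v μ) = ∑ μ, ∑ μ', (star (v μ) ⬝ᵥ v μ').re := by
    have h := star_dotProduct_self (∑ μ, v μ)
    rw [star_sum, sum_dotProduct] at h
    simp only [dotProduct_sum] at h
    have := congrArg Complex.re h
    rw [Complex.ofReal_re, Complex.re_sum] at this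
    rw [← this]
    exact sum_congr rfl fun μ _ => Complex.re_sum _ _
  rw [hsum, hexp]
  refine sum_le_sum fun μ _ => ?_
  have hdiag : nsq (v μ) = (star (v μ) ⬝ᵥ v μ).re := by rw [star_dotProduct_self, Complex.ofReal_re]
  rw [hdiag]
  refine single_le_sum (f := fun μ' => (star (v μ) ⬝ᵥ v μ').re) (fun μ' _ => ?_) (mem_univ μ)
  by_cases h : μ = μ'
  · subst h; rw [← hdiag]; exact nsq_nonneg _
  · exact re_cross_nonneg n M S hS₀ h A

end Coord

/-! ## §5 The ENDs on product regions: the electric operator, the local operator `regionDeltaLoc`, the Hessian budget of `G̃` -/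

/-- **H² OF THE ELECTRIC OPERATOR ON PRODUCT REGIONS**: `Σ_μ ‖W_μ A‖² ≤ ‖(curlRᴴcurlR + gradR·gradRᴴ)A‖²` (every `IsCoordBox`, every
level `n ≥ 2`, every `A`; the directional pieces `W_μ` of `RegionElectricSplitting`). [folklore] -/
theorem hessian_le_nsq_electric (hn : 2 ≤ n) (hS : IsCoordBox M S) (A : {b // starReg n M S b} → ℂ) :
    ∑ μ, nsq (Wdir n M S μ *ᵥ A) ≤ nsq (((curlR n M S)ᴴ * curlR n M S + gradR n M S * (gradR n M S)ᴴ) *ᵥ A) := by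
  obtain ⟨S₀, hS₀⟩ := hS
  rw [electric_splitting_box n M S hn ⟨S₀, hS₀⟩]
  exact sum_nsq_Wdir_le n M S hS₀ A

/-- **H² MODULO A PERTURBATION**: for ANY matrix `P` on the star bonds,
`√(Σ_μ ‖W_μ A‖²) ≤ √‖(curlRᴴcurlR + gradR·gradRᴴ + P)A‖² + √‖P A‖²`. [folklore] -/
theorem sqrt_hessian_le_add (hn : 2 ≤ n) (hS : IsCoordBox M S) (P : Matrix {b // starReg n M S b} {b // starReg n M S b} ℂ)
    (A : {b // starReg n M S b} → ℂ) :
    Real.sqrt (∑ μ, nsq (Wdir n M S μ *ᵥ A))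
      ≤ Real.sqrt (nsq (((curlR n M S)ᴴ * curlR n M S + gradR n M S * (gradR n M S)ᴴ + P) *ᵥ A)) + Real.sqrt (nsq (P *ᵥ A)) := by
  refine (Real.sqrt_le_sqrt (hessian_le_nsq_electric n M S hn hS A)).trans ?_
  have e : ((curlR n M S)ᴴ * curlR n M S + gradR n M S * (gradR n M S)ᴴ) *ᵥ A
      = ((curlR n M S)ᴴ * curlR n M S + gradR n M S * (gradR n M S)ᴴ + P) *ᵥ A + -(P *ᵥ A) := by
    rw [Matrix.add_mulVec _ P]; abel
  rw [e]
  refine (sqrt_nsq_add_le _ _).trans ?_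
  rw [nsq_neg]

/-- **THE LOCAL OPERATOR IS THE SUM OF THE DIRECTIONAL PIECES PLUS THE MASS**: under H1,
`regionDeltaLoc n M a S = Σ_μ Wdir μ + (a n^d)•avgRᴴavgR` (owner O15-a's `RegionGaugeResolventSplit.regionDeltaLoc` BY NAME;
`regionDeltaLoc_eq` + `electric_splitting`). [folklore] -/
theorem regionDeltaLoc_eq_sum_Wdir (a : ℝ) (hH : AtMostOneNeighbour n M S) :
    regionDeltaLoc n M a S = ∑ μ, Wdir n M S μ + ((a * (n : ℝ) ^ d : ℝ) : ℂ) • ((avgR n M S)ᴴ * avgR n M S) := by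
  rw [regionDeltaLoc_eq, electric_splitting n M S hH]

/-- the same on product regions at every level `n ≥ 2`. [folklore] -/
theorem regionDeltaLoc_eq_sum_Wdir_box (a : ℝ) (hn : 2 ≤ n) (hS : IsCoordBox M S) :
    regionDeltaLoc n M a S = ∑ μ, Wdir n M S μ + ((a * (n : ℝ) ^ d : ℝ) : ℂ) • ((avgR n M S)ᴴ * avgR n M S) :=
  regionDeltaLoc_eq_sum_Wdir n M S a (atMostOneNeighbour_of_isCoordBox n M S hn hS)

/-- **THE HESSIAN BOUND FOR THE LOCAL OPERATOR** (`0 ≤ a`): `√(Σ_μ ‖W_μ A‖²) ≤ ‖Δ_loc A‖ + a·‖A‖` for `Δ_loc = regionDeltaLoc n M a S`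
on every product region at every level `n ≥ 2`, every `A`. [folklore] -/
theorem sqrt_hessian_le_loc (hn : 2 ≤ n) (hS : IsCoordBox M S) {a : ℝ} (ha : 0 ≤ a) (A : {b // starReg n M S b} → ℂ) :
    Real.sqrt (∑ μ, nsq (Wdir n M S μ *ᵥ A)) ≤ Real.sqrt (nsq (regionDeltaLoc n M a S *ᵥ A)) + a * Real.sqrt (nsq A) := by
  rw [regionDeltaLoc_eq]
  refine (sqrt_hessian_le_add n M S hn hS ((((a * (n : ℝ) ^ d : ℝ)) : ℂ) • ((avgR n M S)ᴴ * avgR n M S)) A).trans ?_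
  have hm : Real.sqrt (nsq (((((a * (n : ℝ) ^ d : ℝ)) : ℂ) • ((avgR n M S)ᴴ * avgR n M S)) *ᵥ A)) ≤ a * Real.sqrt (nsq A) := by
    rw [Matrix.smul_mulVec, ← Matrix.mulVec_mulVec]
    exact sqrt_nsq_mass_le n M S ha A
  linarith

/-- **THE (R)-HESSIAN BUDGET OF THE LOCAL PROPAGATOR `G̃ = Δ_loc⁻¹`**: if `Δ_loc = regionDeltaLoc n M a S` is invertible with
`‖Δ_loc⁻¹‖ ≤ Γ`, then `√(Σ_μ ‖W_μ (G̃ f)‖²) ≤ (1 + a·Γ)·‖f‖` for every source `f` (product region, level `n ≥ 2`, `0 ≤ a`) — LEVEL-FREE in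
whatever `Γ` is. [folklore] -/
theorem hessian_budget_loc (hn : 2 ≤ n) (hS : IsCoordBox M S) {a : ℝ} (ha : 0 ≤ a) {Γ : ℝ}
    (hunit : IsUnit (regionDeltaLoc n M a S).det) (hΓ : ‖(regionDeltaLoc n M a S)⁻¹‖ ≤ Γ) (f : {b // starReg n M S b} → ℂ) :
    Real.sqrt (∑ μ, nsq (Wdir n M S μ *ᵥ ((regionDeltaLoc n M a S)⁻¹ *ᵥ f))) ≤ (1 + a * Γ) * Real.sqrt (nsq f) := by
  set D := regionDeltaLoc n M a S with hD
  have hDD : D *ᵥ (D⁻¹ *ᵥ f) = f := by rw [Matrix.mulVec_mulVec, Matrix.mul_nonsing_inv _ hunit, Matrix.one_mulVec]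
  have h1 := sqrt_hessian_le_loc n M S hn hS ha (D⁻¹ *ᵥ f)
  rw [← hD, hDD] at h1
  have h2 : Real.sqrt (nsq (D⁻¹ *ᵥ f)) ≤ Γ * Real.sqrt (nsq f) :=
    (sqrt_nsq_mulVec_le _ _).trans (mul_le_mul_of_nonneg_right hΓ (Real.sqrt_nonneg _))
  have h0 : 0 ≤ Real.sqrt (nsq f) := Real.sqrt_nonneg _
  calc _ ≤ Real.sqrt (nsq f) + a * Real.sqrt (nsq (D⁻¹ *ᵥ f)) := h1
    _ ≤ Real.sqrt (nsq f) + a * (Γ * Real.sqrt (nsq f)) := by gcongr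
    _ = (1 + a * Γ) * Real.sqrt (nsq f) := by ring

/-- **THE (R)-HESSIAN BUDGET ON BOXES, UNCONDITIONAL** (`0 < a`, `0 < a′`): W1 on boxes (owner O14-a `RegionSliceCoerciveBox.coercive_regionDeltaA_box`)
and `Δ_a(Ω₀) ≤ Δ_loc(Ω₀)` (owner O15-a `RegionGaugeResolventSplit.opNorm_inv_regionDeltaLoc_le`) give `‖G̃‖ ≤ γ⋆⁻¹`,
`γ⋆ = gamStar d a′ (cW1 d a a′ 4)`, hence `√(Σ_μ ‖W_μ (G̃ f)‖²) ≤ (1 + a·γ⋆⁻¹)·‖f‖` on every coordinate box at every level `n ≥ 2`.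
[folklore] -/
theorem hessian_budget_loc_box (hS : IsCoordBox M S) (hn : 2 ≤ n) {a a' : ℝ} (ha : 0 < a) (ha' : 0 < a')
    (f : {b // starReg n M S b} → ℂ) :
    Real.sqrt (∑ μ, nsq (Wdir n M S μ *ᵥ ((regionDeltaLoc n M a S)⁻¹ *ᵥ f)))
      ≤ (1 + a * (gamStar d a' (cW1 d a a' 4))⁻¹) * Real.sqrt (nsq f) := by
  have hco : Coercive (regionDeltaA n M a a' S) (gamStar d a' (cW1 d a a' 4)) := coercive_regionDeltaA_box n M a a' S hS hn ha ha'
  have hγ : 0 < gamStar d a' (cW1 d a a' 4) := gamStar_pos (d := d) a' (cW1_pos (d := d) a a' ha ha')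
  obtain ⟨hunit, hΓ⟩ := opNorm_inv_regionDeltaLoc_le n M a a' S ha' hγ hco
  exact hessian_budget_loc n M S hn hS ha.le hunit hΓ f

end Region

/-! ## §6 Along the star tower of a box: the level-free Hessian budget at every level `k + 1` -/

section Tower

variable (L : ℕ) [NeZero L] (M : Fin d → ℕ) [hM : ∀ μ, NeZero (M μ)] (S : Tor M → Prop) [DecidablePred S]

/-- **THE HESSIAN BUDGET ALONG THE TOWER**: on a coordinate box, for `L ≥ 2`, `0 < a`, `0 < a′`, at EVERY level `k + 1` (lattice `n = L^{k+1}`)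
the local propagator `G̃_{k+1} = (regionDeltaLoc (lev L (k+1)) M a S)⁻¹` satisfies `√(Σ_μ ‖W_μ (G̃_{k+1} f)‖²) ≤ (1 + a·γ⋆⁻¹)·‖f‖` with ONE
constant for all `k` — the (R)-side Hessian input of the two-level pairing for `Δ_loc` (owner R35 (b): (L) ⟸ (P-gaffney)+(P-mass)+(R)).
[folklore] -/
theorem hessian_budget_loc_lev (hL : 2 ≤ L) (hS : IsCoordBox M S) {a a' : ℝ} (ha : 0 < a) (ha' : 0 < a') (k : ℕ)
    (f : {b // starReg (lev L (k + 1)) M S b} → ℂ) :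
    Real.sqrt (∑ μ, nsq (Wdir (lev L (k + 1)) M S μ *ᵥ ((regionDeltaLoc (lev L (k + 1)) M a S)⁻¹ *ᵥ f)))
      ≤ (1 + a * (gamStar d a' (cW1 d a a' 4))⁻¹) * Real.sqrt (nsq f) :=
  hessian_budget_loc_box (lev L (k + 1)) M S hS (two_le_lev_succ L hL k) ha ha' f

end Tower

end Summit.QuantumFields.BalabanUV.T4Continuum.RegionElectricHessian

end
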